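import Summits.HodgeConjecture.CorCM.IrreducibleOddWeightsSubfamilyDominationClass
import Summits.HodgeConjecture.CorCM.IrreducibleOddWeightsCommutantDominationCMFields
import HarnessLib

/-!
# Sub-family domination, V: a DOMINATING SUB-FAMILY WITH FEW MEMBERS — every product is Hodge-dominated by a
# sub-product of at most `dim Hg(∏ A_i)` factors; in one isotypic class, of at most `r = dim Hg(∏ A_i)/dim A` factors

COR-CM (cell `pub-hodgecm2`, binder seat `b16` gen 74, count-neutral claim SUB-FAMILY DOMINATION AND HODGE
EQUIVALENCE, file S5 — abstract `G`-set level, type ranks, CM dress; theorems only, no definition, no named fact, no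
`sorry`).  NEW as stated, hence under `Summits/`.  HONEST FRAMING: a greedy exchange in the lattice of subspaces of
`ℚ^G` (resp. of `D`-submodules of the reference irreducible), applied to the matrix-coefficient spaces `MC_i`
(`rank Σ − 1 = dim ⨆_i MC_i = dim Hg(∏_i A_i)`); nothing about Hodge classes is asserted, `HC_CM` is neither used nor
asserted.

* §1 `exists_finset_iSup_subtype_eq_card_mul_le` — GREEDY: for subspaces `C_i` of a `ℚ`-space such that `m` divides
  `dim ⨆_{i∈T} C_i` for every finite set of indices `T`, there is `T` with **`⨆_{i∈T} C_i = ⨆_i C_i` and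
  `|T|·m ≤ dim ⨆_i C_i`** (each new member raises the dimension by a positive multiple of `m`).
* §2 **`exists_finset_typeRank_sigmaType_eq_card_le`**: for CM types on non-empty slots there is a non-empty set of
  slots `T` with `rank Σ = rank Σ|_T` and `|T| + 1 ≤ rank Σ` — `∏_i A_i` is Hodge-dominated by a sub-product of at
  most `dim Hg(∏_i A_i)` of its factors (`m = 1`).
* §3 IN ONE ISOTYPIC CLASS (file S4's setting, `A ≠ 0`): **`exists_finset_typeRank_sigmaType_eq_card_mul_le_of_class`:
  `rank Σ = rank Σ|_T` with `|T|·dim A + 1 ≤ rank Σ`** — at most `r = dim Hg(∏_i A_i)/dim A` factors, `r` the D-rank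
  of all the type components (file S3: `dim ⨆_T S(u_t)` is a multiple of `dim A`).
* §4 CM dress: `exists_finset_cmFamilyRank_eq_card_le`, `exists_finset_cmFamilyRank_eq_card_mul_le_of_commutant`.

## References

* [Deligne1982HodgeCycles] P. Deligne, *Hodge cycles on abelian varieties*, LNM 900 (1982), I.5 (p. 53), I Ex. 3.7.
* [Gordon1999HodgeAVSurvey] B. B. Gordon, *A survey of the Hodge conjecture for abelian varieties*, §3 Theorem (proof),
  7.5–7.7.
* [Lang2002] S. Lang, *Algebra*, 3rd ed., XVII §1 (exchange over a division ring), XVII §3.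
* [Mai1989] L. Mai, *Lower bounds for the ranks of CM types*, J. Number Theory 32 (1989), §2 Prop. 1.
-/

set_option autoImplicit false

noncomputable section

open scoped BigOperators Classical

universe u u₀ v vM vY w

/-! ### §1 Greedy: a generating sub-family of at most `dim/m` members -/

namespace Summit.HodgeConjecture.CorCM.IrrOdd

open Literature.NumberTheory.ComplexMultiplication

section Greedy

variable {M : Type vM} [AddCommGroup M] [Module ℚ M] {I : Type u}

/-- `⨆` over the empty set of indices is `⊥`. [folklore] -/
theorem iSup_subtype_finset_empty (C : I → Submodule ℚ M) :
    (⨆ j : {i // i ∈ (∅ : Finset I)}, C j.1) = ⊥ := by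
  rw [eq_bot_iff]
  exact iSup_le fun j => absurd j.2 (Finset.notMem_empty _)

/-- `⨆_{insert a U} C = C a ⊔ ⨆_U C`. [folklore] -/
theorem iSup_subtype_finset_insert (C : I → Submodule ℚ M) (a : I) (U : Finset I) :
    (⨆ j : {i // i ∈ insert a U}, C j.1) = C a ⊔ ⨆ j : {i // i ∈ U}, C j.1 := by
  apply le_antisymm
  · refine iSup_le fun j => ?_
    rcases Finset.mem_insert.1 j.2 with h | h
    · rw [h]; exact le_sup_left
    · exact le_sup_of_le_right (le_iSup (fun j : {i // i ∈ U} => C j.1) ⟨j.1, h⟩)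
  · exact sup_le (le_iSup (fun j : {i // i ∈ insert a U} => C j.1) ⟨a, Finset.mem_insert_self a U⟩)
      (iSup_le fun j => le_iSup (fun j : {i // i ∈ insert a U} => C j.1) ⟨j.1, Finset.mem_insert_of_mem j.2⟩)

/-- `⨆_{univ} C = ⨆_i C_i`. [folklore] -/
theorem iSup_subtype_finset_univ [Fintype I] (C : I → Submodule ℚ M) :
    (⨆ j : {i // i ∈ (Finset.univ : Finset I)}, C j.1) = ⨆ i, C i :=
  le_antisymm (iSup_le fun j => le_iSup C j.1)
    (iSup_le fun i => le_iSup (fun j : {i // i ∈ (Finset.univ : Finset I)} => C j.1) ⟨i, Finset.mem_univ i⟩)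

/-- **GREEDY EXCHANGE.**  `C_i` subspaces of a `ℚ`-space with `⨆_i C_i` finite-dimensional and `m ∣ dim ⨆_{i∈T} C_i`
for every finite `T`; then for every finite `U` there is `T ⊆ U` with **`⨆_T C = ⨆_U C` and `|T|·m ≤ dim ⨆_U C`**
(add a member only when it enlarges the span; each addition raises the dimension by a positive multiple of `m`).
[cite: Lang2002, XVII §1] -/
theorem exists_finset_subset_iSup_subtype_eq_card_mul_le (C : I → Submodule ℚ M)
    [Module.Finite ℚ ↥(⨆ i, C i)] (m : ℕ)
    (hm : ∀ T : Finset I, m ∣ Module.finrank ℚ ↥(⨆ j : {i // i ∈ T}, C j.1)) (U : Finset I) :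
    ∃ T : Finset I, T ⊆ U ∧ (⨆ j : {i // i ∈ T}, C j.1) = (⨆ j : {i // i ∈ U}, C j.1) ∧
      T.card * m ≤ Module.finrank ℚ ↥(⨆ j : {i // i ∈ U}, C j.1) := by
  induction U using Finset.induction_on with
  | empty => exact ⟨∅, Finset.Subset.refl _, rfl, by simp⟩
  | @insert a U haU ih =>
    obtain ⟨T, hTU, hTeq, hTcard⟩ := ih
    have hle : ∀ V : Finset I, (⨆ j : {i // i ∈ V}, C j.1) ≤ ⨆ i, C i :=
      fun V => iSup_le fun j => le_iSup C j.1
    haveI : ∀ V : Finset I, Module.Finite ℚ ↥(⨆ j : {i // i ∈ V}, C j.1) :=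
      fun V => Submodule.finiteDimensional_of_le (hle V)
    by_cases ha : C a ≤ ⨆ j : {i // i ∈ U}, C j.1
    · refine ⟨T, hTU.trans (Finset.subset_insert a U), ?_, ?_⟩
      · rw [iSup_subtype_finset_insert, sup_eq_right.2 ha, hTeq]
      · rw [iSup_subtype_finset_insert, sup_eq_right.2 ha]
        exact hTcard
    · refine ⟨insert a T, Finset.insert_subset_insert a hTU, ?_, ?_⟩
      · rw [iSup_subtype_finset_insert, iSup_subtype_finset_insert, hTeq]
      · -- the span grows strictly, and both dimensions are multiples of `m`
        have hlt : (⨆ j : {i // i ∈ U}, C j.1) < ⨆ j : {i // i ∈ insert a U}, C j.1 := by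
          rw [iSup_subtype_finset_insert]
          exact lt_of_le_of_ne le_sup_right fun h => ha (h ▸ le_sup_left)
        have hdim := Submodule.finrank_lt_finrank_of_lt hlt
        obtain ⟨x, hx⟩ := hm U
        obtain ⟨y, hy⟩ := hm (insert a U)
        rw [Finset.card_insert_of_notMem fun h => haU (hTU h), add_mul, one_mul]
        rw [hx] at hTcard hdim
        rw [hy] at hdim ⊢
        have hxy : x < y := Nat.lt_of_mul_lt_mul_left hdim
        calc T.card * m + m ≤ m * x + m := Nat.add_le_add_right hTcard m
          _ = m * (x + 1) := by ring
          _ ≤ m * y := Nat.mul_le_mul_left m hxy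

/-- **A GENERATING SUB-FAMILY WITH AT MOST `dim/m` MEMBERS**: `⨆_T C = ⨆_i C_i` and `|T|·m ≤ dim ⨆_i C_i`.
[cite: Lang2002, XVII §1] -/
theorem exists_finset_iSup_subtype_eq_card_mul_le [Fintype I] (C : I → Submodule ℚ M)
    [Module.Finite ℚ ↥(⨆ i, C i)] (m : ℕ)
    (hm : ∀ T : Finset I, m ∣ Module.finrank ℚ ↥(⨆ j : {i // i ∈ T}, C j.1)) :
    ∃ T : Finset I, (⨆ j : {i // i ∈ T}, C j.1) = (⨆ i, C i) ∧ T.card * m ≤ Module.finrank ℚ ↥(⨆ i, C i) := by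
  obtain ⟨T, -, hTeq, hTcard⟩ := exists_finset_subset_iSup_subtype_eq_card_mul_le C m hm Finset.univ
  rw [iSup_subtype_finset_univ] at hTeq hTcard
  exact ⟨T, hTeq, hTcard⟩

end Greedy

/-! ### §2 A dominating sub-family of at most `dim Hg(∏ A_i)` members -/

section Family

variable {G : Type w} [Group G] {I : Type u} {E : I → Type v} [∀ i, MulAction G (E i)] [∀ i, Fintype (E i)]
  [Fintype I] [∀ i, Nonempty (E i)]

omit [∀ i, Fintype (E i)] [Fintype I] [∀ i, Nonempty (E i)] in
/-- A matrix coefficient `g ↦ u_i(g·x)` takes the values `±1`, so `MC_i ≠ 0` on a non-empty slot. [folklore] -/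
theorem span_coeff_ne_bot (Φ : ∀ i, Set (E i)) (i : I) [Nonempty (E i)] :
    Submodule.span ℚ (Set.range fun x : E i => fun g : G => antiVec (Φ i) g x) ≠ ⊥ := by
  obtain ⟨x⟩ := ‹Nonempty (E i)›
  intro hbot
  have hmem : (fun g : G => antiVec (Φ i) g x) ∈
      Submodule.span ℚ (Set.range fun x : E i => fun g : G => antiVec (Φ i) g x) := Submodule.subset_span ⟨x, rfl⟩
  rw [hbot, Submodule.mem_bot] at hmem
  have h1 := congrFun hmem (1 : G)
  simp only [antiVec, Pi.zero_apply] at h1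
  by_cases hx : (1 : G) • x ∈ Φ i
  · rw [translateInd_of_mem hx] at h1; norm_num at h1
  · rw [translateInd_of_not_mem hx] at h1; norm_num at h1

/-- **EVERY PRODUCT IS HODGE-DOMINATED BY A SUB-PRODUCT OF AT MOST `dim Hg(∏_i A_i)` FACTORS**: there is a non-empty
set of slots `T` with **`rank Σ = rank Σ|_T` and `|T| + 1 ≤ rank Σ`** (greedy on the `MC_i` in `ℚ^G`, `m = 1`).
[cite: Deligne1982HodgeCycles, I.5 (p. 53)] [cite: Gordon1999HodgeAVSurvey, §3 Theorem (proof), 7.5–7.7] -/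
theorem exists_finset_typeRank_sigmaType_eq_card_le [Nonempty I] {ρ : G} {Φ : ∀ i, Set (E i)}
    (h : ∀ i, IsCMTypeWith ρ (Φ i)) :
    ∃ T : Finset I, T.Nonempty ∧
      typeRank G (sigmaType Φ) = typeRank G (sigmaType fun j : {i // i ∈ T} => Φ j.1) ∧
        T.card + 1 ≤ typeRank G (sigmaType Φ) := by
  obtain ⟨i₀⟩ := ‹Nonempty I›
  haveI := fun i => finite_span_coeff (G := G) (Φ i)
  set C : I → Submodule ℚ (G → ℚ) := fun i =>
    Submodule.span ℚ (Set.range fun x : E i => fun g : G => antiVec (Φ i) g x) with hC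
  haveI : ∀ i, Module.Finite ℚ ↥(C i) := fun i => finite_span_coeff (G := G) (Φ i)
  obtain ⟨T, hTeq, hTcard⟩ := exists_finset_iSup_subtype_eq_card_mul_le C 1 (fun _ => one_dvd _)
  have hTne : T.Nonempty := by
    rw [Finset.nonempty_iff_ne_empty]
    rintro rfl
    rw [iSup_subtype_finset_empty] at hTeq
    exact span_coeff_ne_bot (G := G) Φ i₀ (eq_bot_iff.2 (hTeq.symm ▸ le_iSup C i₀))
  obtain ⟨j₁, hj₁⟩ := hTne
  haveI : Nonempty (Σ j : {i // i ∈ T}, E (Subtype.val j)) := ⟨⟨⟨j₁, hj₁⟩, Classical.arbitrary (E j₁)⟩⟩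
  haveI : Nonempty (Σ i, E i) := ⟨⟨i₀, Classical.arbitrary (E i₀)⟩⟩
  refine ⟨T, ⟨j₁, hj₁⟩, ?_, ?_⟩
  · exact (typeRank_sigmaType_eq_reindex_iff_iSup_span_coeff_eq h (Subtype.val : {i // i ∈ T} → I)).2 hTeq
  · rw [(IsCMTypeWith.sigmaType h).typeRank_eq_finrank_antiSpan_add_one,
      finrank_antiSpan_sigmaType_eq_finrank_iSup_span_coeff Φ]
    rw [mul_one] at hTcard
    exact Nat.add_le_add_right hTcard 1

/-! ### §3 In one isotypic class: at most `r = dim Hg(∏ A_i)/dim A` members -/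

variable {Y : Type vY} [MulAction G Y] [Fintype Y]

/-- **IN ONE ISOTYPIC CLASS, `∏_i A_i` IS HODGE-DOMINATED BY A SUB-PRODUCT OF AT MOST `dim Hg(∏_i A_i)/dim A` FACTORS**:
with all type vectors `u_i = Σ_j ι^i_j(b^i_j)` assembled from one reference stable irreducible `A ≠ 0` (commutant ANY),
there is a non-empty `T` with **`rank Σ = rank Σ|_T` and `|T|·dim A + 1 ≤ rank Σ`** — i.e. `|T| ≤ r`, `r` the D-rank of
all the components (file S4: `rank Σ = r·dim A + 1`); greedy with `m = dim A` (file S3: every `dim ⨆_T S(u_t)` is a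
multiple of `dim A`). [cite: Mai1989, §2 Prop. 1 (proof)] [cite: Lang2002, XVII §1 and §3]
[cite: Deligne1982HodgeCycles, I.5 (p. 53)] -/
theorem exists_finset_typeRank_sigmaType_eq_card_mul_le_of_class [Nonempty I] {ρ : G} {Φ : ∀ i, Set (E i)}
    (h : ∀ i, IsCMTypeWith ρ (Φ i)) {A : Submodule ℚ (Y → ℚ)} {𝒟 : Submodule ℚ ((Y → ℚ) →ₗ[ℚ] (Y → ℚ))}
    (h𝒟 : ∀ L : (Y → ℚ) →ₗ[ℚ] (Y → ℚ), L ∈ 𝒟 ↔ (∀ a ∈ A, L a ∈ A) ∧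
      ∀ (k : G) (a : Y → ℚ), a ∈ A → L (fun y => a (k • y)) = fun y => L a (k • y))
    (hAst : ∀ (k : G) (a : Y → ℚ), a ∈ A → (fun y => a (k • y)) ∈ A)
    (hAirr : ∀ W : Submodule ℚ (Y → ℚ), W ≤ A → W ≠ ⊥ →
      (∀ (k : G) (f : Y → ℚ), f ∈ W → (fun y => f (k • y)) ∈ W) → W = A)
    (hA0 : A ≠ ⊥) {J : I → Type u₀} [∀ i, Fintype (J i)] (ι : ∀ i, J i → ((Y → ℚ) →ₗ[ℚ] (E i → ℚ)))
    (hιeq : ∀ i (j : J i) (k : G) (a : Y → ℚ), a ∈ A → ι i j (fun y => a (k • y)) = fun y => ι i j a (k • y))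
    (hind : ∀ i (f : J i → (Y → ℚ)), (∀ j, f j ∈ A) → ∑ j, ι i j (f j) = 0 → ∀ j, f j = 0)
    {b : ∀ i, J i → (Y → ℚ)} (hb : ∀ i j, b i j ∈ A) (hu : ∀ i, antiVec (Φ i) (1 : G) = ∑ j, ι i j (b i j)) :
    ∃ T : Finset I, T.Nonempty ∧
      typeRank G (sigmaType Φ) = typeRank G (sigmaType fun j : {i // i ∈ T} => Φ j.1) ∧
        T.card * Module.finrank ℚ A + 1 ≤ typeRank G (sigmaType Φ) := by
  obtain ⟨i₀⟩ := ‹Nonempty I›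
  obtain ⟨a₀, ha₀, h0⟩ := Submodule.exists_mem_ne_zero_of_ne_bot hA0
  set C : I → Submodule ℚ (G → ℚ) := fun i =>
    Submodule.span ℚ (Set.range fun x : E i => fun g : G => antiVec (Φ i) g x) with hC
  haveI : ∀ i, Module.Finite ℚ ↥(C i) := fun i => finite_span_coeff (G := G) (Φ i)
  -- `dim A ∣ dim ⨆_T MC` for every `T` (file S3 on the sub-family of pivots indexed by `T`)
  have hm : ∀ T : Finset I, Module.finrank ℚ A ∣ Module.finrank ℚ ↥(⨆ j : {i // i ∈ T}, C j.1) := by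
    intro T
    obtain ⟨r, -, -, hS⟩ := exists_rank_finrank_iSup_span_shadowCoeff_eq (Yf := fun j : {i // i ∈ T} => E j.1) h𝒟
      hAst hAirr (fun j => ι j.1) (fun j => hιeq j.1) (fun j => hind j.1) (fun j => hb j.1) ha₀ h0
    rw [← iSup_span_coeff_eq_iSup_span_shadowCoeff_of_eq (E := fun j : {i // i ∈ T} => E j.1) (fun j => Φ j.1)
      (fun j => ι j.1) (fun j => b j.1) fun j => hu j.1] at hS
    exact ⟨r, by rw [hS, mul_comm]⟩
  obtain ⟨T, hTeq, hTcard⟩ := exists_finset_iSup_subtype_eq_card_mul_le C (Module.finrank ℚ A) hm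
  have hTne : T.Nonempty := by
    rw [Finset.nonempty_iff_ne_empty]
    rintro rfl
    rw [iSup_subtype_finset_empty] at hTeq
    exact span_coeff_ne_bot (G := G) Φ i₀ (eq_bot_iff.2 (hTeq.symm ▸ le_iSup C i₀))
  obtain ⟨j₁, hj₁⟩ := hTne
  haveI : Nonempty (Σ j : {i // i ∈ T}, E (Subtype.val j)) := ⟨⟨⟨j₁, hj₁⟩, Classical.arbitrary (E j₁)⟩⟩
  haveI : Nonempty (Σ i, E i) := ⟨⟨i₀, Classical.arbitrary (E i₀)⟩⟩
  refine ⟨T, ⟨j₁, hj₁⟩, ?_, ?_⟩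
  · exact (typeRank_sigmaType_eq_reindex_iff_iSup_span_coeff_eq h (Subtype.val : {i // i ∈ T} → I)).2 hTeq
  · rw [(IsCMTypeWith.sigmaType h).typeRank_eq_finrank_antiSpan_add_one,
      finrank_antiSpan_sigmaType_eq_finrank_iSup_span_coeff Φ]
    exact Nat.add_le_add_right hTcard 1

end Family

end Summit.HodgeConjecture.CorCM.IrrOdd

/-! ### §4 CM dress -/

namespace Summit.HodgeConjecture.CorCM

open CategoryTheory CategoryTheory.Limits NumberField Module IntermediateField
open Literature.NumberTheory.ComplexMultiplication
open Literature.AlgebraicGeometry.Motives (AbelianVariety CMType)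
open Literature.AlgebraicGeometry.Motives.AbelianVariety
open Literature.AlgebraicGeometry.HodgeTheory
open Literature.AlgebraicGeometry.ComplexMultiplication (IsCMTypeRealisation)
open Literature.AlgebraicGeometry.Pohlmann1968

variable {I : Type} [Fintype I] {K : I → Type} [∀ i, Field (K i)] [∀ i, NumberField (K i)] [∀ i, IsCMField (K i)]
  {Y : Type vY} [MulAction (ℂ ≃+* ℂ) Y] [Fintype Y]

/-- **`∏_i A_i` IS HODGE-DOMINATED BY A SUB-PRODUCT OF AT MOST `dim Hg(∏_i A_i)` FACTORS (CM fields)**: a non-empty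
`T ⊆ I` with `cmFamilyRank Φ = cmFamilyRank Φ|_T` (`MT(∏_I A_i) → MT(∏_T A_i)` an isogeny) and `|T| + 1 ≤ cmFamilyRank Φ`.
[cite: Deligne1982HodgeCycles, I.5 (p. 53)] [cite: Gordon1999HodgeAVSurvey, §3 Theorem (proof), 7.5–7.7] -/
theorem exists_finset_cmFamilyRank_eq_card_le [Nonempty I] (Φ : ∀ i, CMType (K i)) :
    ∃ T : Finset I, T.Nonempty ∧ CMAlgebra.cmFamilyRank Φ = CMAlgebra.cmFamilyRank (fun j : T => Φ j.1) ∧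
      T.card + 1 ≤ CMAlgebra.cmFamilyRank Φ := by
  haveI : ∀ i, Nonempty (K i →+* ℂ) := fun i => inferInstance
  exact IrrOdd.exists_finset_typeRank_sigmaType_eq_card_le (G := ℂ ≃+* ℂ) (E := fun i => K i →+* ℂ)
    (Φ := fun i => (Φ i).1) (fun i => isCMTypeWith_conj (Φ i))

/-- **IN ONE ISOTYPIC CLASS, AT MOST `dim Hg(∏_i A_i)/dim A` FACTORS (CM fields)**: with all type vectors
`u_i = Σ_j ι^i_j(b^i_j)` assembled from one reference `Aut(ℂ)`-stable irreducible `A ≠ 0`, a non-empty `T` with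
`cmFamilyRank Φ = cmFamilyRank Φ|_T` and **`|T|·dim A + 1 ≤ cmFamilyRank Φ`**. [cite: Mai1989, §2 Prop. 1 (proof)]
[cite: Lang2002, XVII §1 and §3] [cite: Deligne1982HodgeCycles, I.5 (p. 53)] -/
theorem exists_finset_cmFamilyRank_eq_card_mul_le_of_commutant [Nonempty I] (Φ : ∀ i, CMType (K i))
    {A : Submodule ℚ (Y → ℚ)} {𝒟 : Submodule ℚ ((Y → ℚ) →ₗ[ℚ] (Y → ℚ))}
    (h𝒟 : ∀ L : (Y → ℚ) →ₗ[ℚ] (Y → ℚ), L ∈ 𝒟 ↔ (∀ a ∈ A, L a ∈ A) ∧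
      ∀ (k : ℂ ≃+* ℂ) (a : Y → ℚ), a ∈ A → L (fun y => a (k • y)) = fun y => L a (k • y))
    (hAst : ∀ (k : ℂ ≃+* ℂ) (a : Y → ℚ), a ∈ A → (fun y => a (k • y)) ∈ A)
    (hAirr : ∀ W : Submodule ℚ (Y → ℚ), W ≤ A → W ≠ ⊥ →
      (∀ (k : ℂ ≃+* ℂ) (f : Y → ℚ), f ∈ W → (fun y => f (k • y)) ∈ W) → W = A)
    (hA0 : A ≠ ⊥) {J : I → Type} [∀ i, Fintype (J i)] (ι : ∀ i, J i → ((Y → ℚ) →ₗ[ℚ] ((K i →+* ℂ) → ℚ)))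
    (hιeq : ∀ i (j : J i) (k : ℂ ≃+* ℂ) (a : Y → ℚ), a ∈ A → ι i j (fun y => a (k • y)) = fun y => ι i j a (k • y))
    (hind : ∀ i (f : J i → (Y → ℚ)), (∀ j, f j ∈ A) → ∑ j, ι i j (f j) = 0 → ∀ j, f j = 0)
    {b : ∀ i, J i → (Y → ℚ)} (hb : ∀ i j, b i j ∈ A)
    (hu : ∀ i, antiVec (Φ i).1 (1 : ℂ ≃+* ℂ) = ∑ j, ι i j (b i j)) :
    ∃ T : Finset I, T.Nonempty ∧ CMAlgebra.cmFamilyRank Φ = CMAlgebra.cmFamilyRank (fun j : T => Φ j.1) ∧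
      T.card * Module.finrank ℚ A + 1 ≤ CMAlgebra.cmFamilyRank Φ := by
  haveI : ∀ i, Nonempty (K i →+* ℂ) := fun i => inferInstance
  exact IrrOdd.exists_finset_typeRank_sigmaType_eq_card_mul_le_of_class (G := ℂ ≃+* ℂ) (E := fun i => K i →+* ℂ)
    (Φ := fun i => (Φ i).1) (fun i => isCMTypeWith_conj (Φ i)) h𝒟 hAst hAirr hA0 ι hιeq hind hb hu

end Summit.HodgeConjecture.CorCM

end
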